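import Literature.Computability.MetaComplexity.LanguageCompressionNP
import HarnessLib

/-!
# Complexity meta: the randomised test `B'(x, 1ᵗ; z) = B(DP_{k(t)}(x; z), 1^{⟨n,k(t),t⟩})` of the proof of Thm. 4.2 (Hirahara 2021)

Topic `Literature/Computability/MetaComplexity`, part of the inline proof plan of
`Hirahara2021_languageCompression` (S. Hirahara, ECCC TR21-058 (2021), Thm. 4.2, proof on
pp. 28–29), sequel of `LanguageCompressionNP.lean` (the `NP` language `L'` = `dpLang L`). The printed
proof sets `k(t) := log A(1ᵗ) + d log t` (with `A` the estimator of `|L_t|` of Lemma 4.5) and runs,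
on input `(x, 1ᵗ)` and coins `z ← {0,1}^{nk(t)}`, the heuristic `B` on `(DP_{k(t)}(x; z), 1^{⟨n,t⟩})`
("We present a randomized algorithm `B'` … accepts if and only if `B(DP_{k(t)}(x; z), 1^{⟨n,t⟩}) = 1`",
p. 28). This file builds that test as a polynomial-time map, for an abstract unary log-size
estimator `κU` (`1ᵗ ↦ 1^{κ(t)}`, to be supplied by Lemma 4.5) and slack constant `E`:

* `LCTest.lam E t = E (⌊log₂(t+2)⌋ + 1)` (the `d log t`, via the tree's `lamUF`), `LCTest.kap κU t = κ(t)`,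
  `LCTest.kOf κU E t = κ(t) + Λ(t)` = `k(t)`; `(t+2)^E ≤ 2^{Λ(t)} ≤ (2(t+2))^E`;
* `LCTest.GF κU E` — the `FP` map `⟨(x, 1ᵗ), y⟩ ↦ (DP_{k(t)}(x; y ↾ nk(t)), 1^{⟨n, k(t), t⟩})`, `n = |x|`
  (bricks `kU`, `zF`, `dpF`, `idxF`; `GF_boolPair`, `GF_mem_FP`);
* `LCTest.testLang κU E D₀ = GF ⁻¹' D₀` — the witness language "`B` accepts `DP_{k(t)}(x; z)` at the index
  `⟨n, k(t), t⟩`" for a heuristic `D₀ ∈ P` (`testLang_mem_P`, `boolPair_mem_testLang_iff`);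
* `LCTest.exists_poly_kOf_le` — `k(t) ≤ K_b(t)` for a polynomial `K_b` (the coin length `n k(t)` is
  polynomial in `|(x, 1ᵗ)|`; via the tree's `exists_poly_length_le_of_mem_FP`).

## References

* S. Hirahara, ECCC TR21-058 (2021), proof of Thm. 4.2 (p. 28: `k(t)`, `B'`), Claim 4.7 [Hirahara2021].
* S. Arora, B. Barak, *Computational Complexity: A Modern Approach*, CUP 2009, §1.3 [AroraBarakCC2009].
-/

noncomputable section

namespace Literature.Computability.MetaComplexity

open _root_.Computability Polynomial Complexity Complexity.Classes Complexity.Brick Complexity.Plumb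
  Complexity.HashBricks Complexity.OracleCompose Cryptography

namespace LCTest

variable (κU : List Bool → List Bool) (E : ℕ)

/-! ### The parameters `Λ(t)`, `κ(t)`, `k(t)` -/

/-- The slack `Λ(t) = E (⌊log₂ (t+2)⌋ + 1)` (the printed `d log t`). [cite: Hirahara2021, Thm. 4.2 (proof, "k(t) := log A(1ᵗ) + d log t")] -/
def lam (t : ℕ) : ℕ := E * (Nat.log 2 (t + 2) + 1)

/-- The estimated log-size `κ(t) = |κU(1ᵗ)|` (in the assembly: `⌊log₂ A(1ᵗ)⌋ + 1` for the estimator `A`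
of Lemma 4.5). [cite: Hirahara2021, Thm. 4.2 (proof), Lemma 4.5] -/
def kap (t : ℕ) : ℕ := (κU (unaryEncodeNat t)).length

/-- **The direct-product parameter `k(t) = κ(t) + Λ(t)`.** [cite: Hirahara2021, Thm. 4.2 (proof, "k(t)")] -/
def kOf (t : ℕ) : ℕ := kap κU t + lam E t

/-- `(t+2)^E ≤ 2^{Λ(t)}` (`2^{⌊log₂ x⌋ + 1} > x`). [folklore] -/
theorem pow_le_two_pow_lam (t : ℕ) : (t + 2) ^ E ≤ 2 ^ lam E t := by
  unfold lam
  rw [mul_comm, pow_mul]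
  exact Nat.pow_le_pow_left (Nat.lt_pow_succ_log_self one_lt_two (t + 2)).le E

/-- `2^{Λ(t)} ≤ (2(t+2))^E` (`2^{⌊log₂ x⌋} ≤ x`). [folklore] -/
theorem two_pow_lam_le (t : ℕ) : 2 ^ lam E t ≤ (2 * (t + 2)) ^ E := by
  unfold lam
  rw [mul_comm E, pow_mul]
  refine Nat.pow_le_pow_left ?_ E
  rw [pow_succ, mul_comm]
  exact Nat.mul_le_mul_left 2 (Nat.pow_log_le_self 2 (by omega))

/-- `Λ(t) ≤ E (t + 3)` (crude). [folklore] -/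
theorem lam_le (t : ℕ) : lam E t ≤ E * (t + 3) := by
  unfold lam
  refine Nat.mul_le_mul_left E ?_
  have : Nat.log 2 (t + 2) ≤ t + 2 := (Nat.log_le_self 2 _)
  omega

variable {κU}

/-- **`k(t)` is polynomially bounded**: `k(t) ≤ K_b(t)` with `K_b = q_κ + E(X + 3)`. [folklore] -/
theorem exists_poly_kOf_le (hκ : κU ∈ FP) (E : ℕ) : ∃ Kb : Polynomial ℕ, ∀ t, kOf κU E t ≤ Kb.eval t := by
  obtain ⟨q, hq⟩ := exists_poly_length_le_of_mem_FP hκ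
  refine ⟨q + C E * (X + 3), fun t => ?_⟩
  have h1 : kap κU t ≤ q.eval t := by
    have h := hq (unaryEncodeNat t)
    rwa [show (unaryEncodeNat t).length = t from unary_decode_encode_nat t] at h
  have h2 := lam_le E t
  simp only [kOf, eval_add, eval_mul, eval_C, eval_X, eval_ofNat]
  omega

variable (κU)

/-! ### The bricks -/

/-- `kU u = 1^{k(|u|)}`. [folklore] -/
def kU : List Bool → List Bool := concatFn ∘ fanoutFn (onesFn ∘ κU ∘ onesFn) (lamUF E ∘ onesFn)

/-- `x` from `⟨(x, 1ᵗ), y⟩`. [folklore] -/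
def xF : List Bool → List Bool := fstF ∘ fstF
/-- `1ᵗ` part (raw) from `⟨(x, 1ᵗ), y⟩`. [folklore] -/
def uF : List Bool → List Bool := sndF ∘ fstF
/-- `1ⁿ`, `n = |x|`. [folklore] -/
def nU : List Bool → List Bool := onesFn ∘ xF
/-- `1^{k(t)}`. [folklore] -/
def ktU : List Bool → List Bool := kU κU E ∘ uF
/-- The seed `z = y ↾ n k(t)`. [folklore] -/
def zF : List Bool → List Bool := takeFn ∘ fanoutFn (umulFn ∘ fanoutFn nU (ktU κU E)) sndF
/-- `DP_{k(t)}(x; z) = z ‖ glBits k(t) n x z`. [folklore] -/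
def dpF : List Bool → List Bool :=
  fun π => zF κU E π ++ (L53Prog.glFn ∘ fanoutFn (fanoutFn (ktU κU E) nU) (fanoutFn xF (zF κU E))) π
/-- `1^{⟨n, k(t), t⟩}`. [folklore] -/
def idxF : List Bool → List Bool := idx3UF ∘ fanoutFn nU (fanoutFn (ktU κU E) (onesFn ∘ uF))

/-- **The map `⟨(x, 1ᵗ), y⟩ ↦ (DP_{k(t)}(x; y ↾ nk(t)), 1^{⟨n, k(t), t⟩})`** — the instance of `L'` on
which the heuristic is run by the randomised algorithm `B'` of the proof of Thm. 4.2.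
[cite: Hirahara2021, Thm. 4.2 (proof, the algorithm B')] -/
def GF : List Bool → List Bool := fanoutFn (dpF κU E) (idxF κU E)

variable {κU E}

/-- `unaryEncodeNat = ones`. [folklore] -/
private theorem unary_eq_ones (n : ℕ) : unaryEncodeNat n = ones n := Complexity.unaryEncodeNat_eq_replicate n

/-- Value of `kU`: `kU u = 1^{k(|u|)}`. [folklore] -/
theorem kU_apply (u : List Bool) : kU κU E u = ones (kOf κU E u.length) := by
  simp only [kU, Function.comp_apply, fanoutFn_apply, concatFn_boolPair, onesFn, unary_eq_ones u.length, lamUF_apply,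
    kOf, kap, lam]
  rw [← unary_eq_ones u.length, unary_eq_ones (κU (unaryEncodeNat u.length)).length]
  exact List.replicate_append_replicate ..

/-- **Value of `GF`** on `⟨(x, u), y⟩` (`t = |u|`, `n = |x|`, `k = k(t)`):
`(DP_k(x; y ↾ nk), 1^{⟨n, k, t⟩})`. [cite: Hirahara2021, Thm. 4.2 (proof, B')] -/
theorem GF_boolPair (x u y : List Bool) :
    GF κU E (boolPair (boolPair x u) y) =
      paramEnc (dpGen (kOf κU E u.length) x (y.take (x.length * kOf κU E u.length)),
        idx3 x.length (kOf κU E u.length) u.length) := by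
  set k := kOf κU E u.length with hk
  set π := boolPair (boolPair x u) y with hπ
  have hlen : ∀ m, (ones m).length = m := fun m => by simp [ones]
  have hx : xF π = x := by simp [xF, hπ]
  have hu : uF π = u := by simp [uF, hπ]
  have hn : nU π = ones x.length := by simp [nU, hx, onesFn, unary_eq_ones]
  have hkt : ktU κU E π = ones k := by rw [ktU, Function.comp_apply, hu, kU_apply]
  have hz : zF κU E π = y.take (x.length * k) := by
    rw [zF, Function.comp_apply, fanoutFn_apply, Function.comp_apply, fanoutFn_apply, hn, hkt, umulFn_boolPair,
      takeFn_boolPair, hlen]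
    simp [hπ]
  have hdp : dpF κU E π = dpGen k x (y.take (x.length * k)) := by
    simp only [dpF, Function.comp_apply, fanoutFn_apply, hz, hkt, hn, hx, L53Prog.glFn_boolPair]
    rfl
  have hidx : idxF κU E π = ones (idx3 x.length k u.length) := by
    rw [idxF, Function.comp_apply, fanoutFn_apply, fanoutFn_apply, hn, hkt, Function.comp_apply, hu,
      show onesFn u = ones u.length by simp [onesFn, unary_eq_ones], idx3UF_apply]
  rw [GF, fanoutFn_apply, hdp, hidx, paramEnc, unary_eq_ones]

/-- **`GF ∈ FP`** for `κU ∈ FP`. [cite: AroraBarakCC2009, §1.3] -/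
theorem GF_mem_FP (hκ : κU ∈ FP) (E : ℕ) : GF κU E ∈ FP := by
  have hkU : kU κU E ∈ FP :=
    comp_mem_FP concatFn_mem_FP (fanoutFn_mem_FP (comp_mem_FP onesFn_mem_FP (comp_mem_FP hκ onesFn_mem_FP))
      (comp_mem_FP (lamUF_mem_FP E) onesFn_mem_FP))
  have hx : xF ∈ FP := comp_mem_FP fstF_mem_FP fstF_mem_FP
  have hu : uF ∈ FP := comp_mem_FP sndF_mem_FP fstF_mem_FP
  have hn : nU ∈ FP := comp_mem_FP onesFn_mem_FP hx
  have hkt : ktU κU E ∈ FP := comp_mem_FP hkU hu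
  have hz : zF κU E ∈ FP :=
    comp_mem_FP takeFn_mem_FP (fanoutFn_mem_FP (comp_mem_FP umulFn_mem_FP (fanoutFn_mem_FP hn hkt)) sndF_mem_FP)
  have hdp : dpF κU E ∈ FP := by
    unfold dpF
    exact append_mem_FP hz (comp_mem_FP L53Prog.glFn_mem_FP (fanoutFn_mem_FP (fanoutFn_mem_FP hkt hn) (fanoutFn_mem_FP hx hz)))
  have hidx : idxF κU E ∈ FP :=
    comp_mem_FP idx3UF_mem_FP (fanoutFn_mem_FP hn (fanoutFn_mem_FP hkt (comp_mem_FP onesFn_mem_FP hu)))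
  exact fanoutFn_mem_FP hdp hidx

/-! ### The witness language of `B'` -/

variable (κU E)

/-- **The witness language of the randomised algorithm `B'`**: `⟨(x, 1ᵗ), y⟩` is accepted iff the
heuristic `D₀` accepts `(DP_{k(t)}(x; y ↾ nk(t)), 1^{⟨n, k(t), t⟩})`.
[cite: Hirahara2021, Thm. 4.2 (proof, "accepts if and only if B(DP_{k(t)}(x; z), 1^{⟨n,t⟩}) = 1")] -/
def testLang (D₀ : Language Bool) : Language Bool := GF κU E ⁻¹' D₀

variable {κU E}

/-- Membership of `⟨(x, 1ᵗ), y⟩` in the witness language. [cite: Hirahara2021, Thm. 4.2 (proof, B')] -/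
theorem boolPair_mem_testLang_iff (D₀ : Language Bool) (x : List Bool) (t : ℕ) (y : List Bool) :
    boolPair (paramEnc (x, t)) y ∈ testLang κU E D₀ ↔
      paramEnc (dpGen (kOf κU E t) x (y.take (x.length * kOf κU E t)), idx3 x.length (kOf κU E t) t) ∈ D₀ := by
  change GF κU E (boolPair (paramEnc (x, t)) y) ∈ D₀ ↔ _
  rw [paramEnc, GF_boolPair, show (unaryEncodeNat t).length = t from unary_decode_encode_nat t]

/-- **The witness language is in `P`** for `D₀ ∈ P` and `κU ∈ FP`. [cite: AroraBarakCC2009, §1.3] -/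
theorem testLang_mem_P (hκ : κU ∈ FP) (E : ℕ) {D₀ : Language Bool} (hD₀ : D₀ ∈ Classes.P) :
    testLang κU E D₀ ∈ Classes.P :=
  preimage_mem_P hD₀ (GF_mem_FP hκ E)

end LCTest

end Literature.Computability.MetaComplexity
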